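import Literature.NumberTheory.Automorphic.LanglandsTunnellReduction
import Literature.NumberTheory.Automorphic.LanglandsTunnellModThree
import Literature.NumberTheory.GaloisRepresentations.ArtinCharacterReciprocityProofs
import Literature.NumberTheory.Automorphic.TunnellOctahedralGlobalProofs
import Literature.NumberTheory.Automorphic.PiOfArtinRepFrobSatakeCompatibleProofs
import Literature.NumberTheory.GaloisRepresentations.GL2F3Lift
import HarnessLib

/-!
# stub-ideation k2 · generation 13 · `stub_modThree` (S1a) — companion to `STUB-IDEAS-stub_modThree-2.md`

HOME = FAMILY 2 (RESHAPE).  Contents: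

* `SigStubModThree` — the registered stub verbatim (`Lines/Sketch.lean` l.143).
* `stubModThree_of_open_leaves` — PLAN OF RECORD R1 re-checked against today's tree (kernel-checked,
  no `sorry`): the stub from the EIGHT open Langlands–Tunnell leaves (gen-11 companion, unchanged).
* `cubeRootOfUnity_eq_one_of_charP_three` — the checkable kernel of reshape probe T9 (PROVED): in
  characteristic `3` every cube root of unity is `1`, so the cubic-twist ambiguity `t ↦ {ν a, ν⁻¹ b}`
  (`ν³ = 1`) of Langlands' tetrahedral step is invisible modulo a prime over `3`.
* `SwitchIntoTwoGroupThree` — the typed form of reshape probe T10 (re-cut of `stub_switch` so that the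
  partner's mod-3 image is a 2-group), recorded DEAD (genus census in the .md); NOT to be staffed.
-/

open scoped MatrixGroups NumberField
open Literature.NumberTheory.EllipticCurves
open Literature.NumberTheory.Automorphic
open Literature.NumberTheory.GaloisRepresentations
open WeierstrassCurve

set_option linter.dupNamespace false

namespace Summit.ABC.ABC.Cruxes.FreyModularity.StubModThreeIdeasK2G13

/-- The registered stub `stub_modThree`, verbatim. -/
def SigStubModThree : Prop :=
  ∀ (W : WeierstrassCurve ℚ) [W.IsElliptic] (ρ : ModPGaloisRep ℚ (ZMod 3) 2),
    W.IsTorsionGaloisRep 3 ρ → FramedRep.IsAbsolutelyIrreducible ρ → ρ.IsModular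

/-- **R1 (plan of record, re-checked 2026-09-01).** The stub from the eight open Langlands–Tunnell
leaves; the two discharged leaves (`artinReciprocity_character_holds`,
`exists_twist_quadraticSign_holds`) and the Frobenius/Satake compatibility
(`frobSatakeCompatibleAt_of_isPiOfArtinRep_holds`) are supplied from the tree. -/
theorem stubModThree_of_open_leaves
    (hAI : automorphicInduction_character)
    (hdesc3 : exists_cuspidal_descent_det_cubic) (hGJ : GelbartJacquet_adjoint_lift)
    (hJS : JacquetShalika_eq_of_rsData_eq) (hdesc : cuspidal_descent_cyclic)
    (ha : ArthurClozel_fibres_quadratic) (hb : tunnell_cuspidal_cubic_lifts)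
    (hW1 : exists_isNewform1_of_isPiOfArtinRep) : SigStubModThree :=
  fun W _ ρ hρ habs ↦
    W.isModular_of_isTorsionGaloisRep_three_of_langlands_tunnell
      (langlands_tunnell_of_leaves artinReciprocity_character_holds hAI hdesc3 hGJ hJS hdesc
        exists_twist_quadraticSign_holds ha hb frobSatakeCompatibleAt_of_isPiOfArtinRep_holds hW1)
      ρ hρ habs

/-- **T9 kernel (PROVED, S).** In a field of characteristic `3` the only cube root of unity is `1`
(`z³ - 1 = (z - 1)³`).  Consequence used in the .md: the three candidates `{ν a, ν⁻¹ b}` (`ν³ = 1`) for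
the Satake datum of a cubic descent at a place inert in `M/E` all reduce to `{a, b}` modulo a prime
over `3` — the Gelbart–Jacquet/Jacquet–Shalika twist-fixing step is vacuous for a MOD-3 target. -/
theorem cubeRootOfUnity_eq_one_of_charP_three {F : Type*} [Field F] [CharP F 3] (z : F)
    (hz : z ^ 3 = 1) : z = 1 := by
  haveI : Fact (Nat.Prime 3) := ⟨Nat.prime_three⟩
  have h : (z - 1) ^ 3 = 0 := by
    rw [sub_pow_char (p := 3) z 1, hz, one_pow, sub_self]
  exact sub_eq_zero.mp (pow_eq_zero_iff (by norm_num) |>.mp h)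

/-- **T10 (DEAD — do not staff).** The re-cut of `stub_switch` that would route EVERY case through the
2-group half of `stub_modThree` (CM theta series, no Langlands–Tunnell): a `5`-congruent partner whose
mod-`3` representation has `2`-group image.  Such partners are rational points of
`X_W(5) ×_{X(1)} X_{N(C_ns)}(3)` (genus `10`) or `×_{X(1)} X_{N(C_s)}(3)` (genus `19`): Faltings-finite
for each `W`, so no `∀ W` statement is available (contrast: Wiles' "surjective mod 3" partner is an OPEN
condition on `X_W(5) ≅ ℙ¹`, supplied by Hilbert irreducibility). -/
def SwitchIntoTwoGroupThree : Prop :=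
  ∀ (W : WeierstrassCurve ℚ) [W.IsElliptic], ¬ 27 ∣ W.conductorNorm ℤ →
    ∀ (ρ : ModPGaloisRep ℚ (ZMod 5) 2), W.IsTorsionGaloisRep 5 ρ → ρ.IsAbsIrreducibleOverSqrt 5 →
    ∃ (W' : WeierstrassCurve ℚ) (_ : W'.IsElliptic), W'.IsTorsionGaloisRep 5 ρ ∧
      ∃ ρ₃' : ModPGaloisRep ℚ (ZMod 3) 2, W'.IsTorsionGaloisRep 3 ρ₃' ∧
        FramedRep.IsAbsolutelyIrreducible ρ₃' ∧ IsPGroup 2 ρ₃'.toMonoidHom.range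

end Summit.ABC.ABC.Cruxes.FreyModularity.StubModThreeIdeasK2G13
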